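import Literature.Analysis.FluidPDE.NewtonNearGradPotential
import Literature.Analysis.FluidPDE.NewtonLocalPotential
import Literature.Analysis.FluidPDE.BiotSavartNewtonKernel
import Literature.Analysis.FluidPDE.OnsagerBDSVSchauderHigher
import Literature.Analysis.FluidPDE.LagrangianVelocityTimeDerivative
import Literature.Analysis.FunctionSpaces.TorusPeriodization
import Literature.Analysis.FunctionSpaces.TorusInverseLaplacianSup
import HarnessLib

/-!
# The Riesz–Hessian transforms of the flat torus as truncated Newtonian singular integrals
# of the periodic lift (transfer `T³ → ℝ³` for the commutator estimate BDSV App. D, Prop. D.1)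

Analysis/FluidPDE support file (everything proved; no definitions, no named facts), first of the
files discharging `BDSV.commutatorCZBound` (`OnsagerBDSVPotentialTheory.lean`; Buckmaster–De
Lellis–Székelyhidi–Vicol, CPAM 72 (2019) = arXiv:1701.08678, App. D, Prop. D.1, whose printed proof
for `N = 0` is "precisely Lemma 1 in [Co2015] … if `f` is the `1`-periodic extension … and `χ` a
smooth cutoff … `T_K f(x) = p.v.∫_{ℝ³} K(x-y)χ(y)f(y)dy + T_smooth f(x)`, where
`T_smooth : C⁰(T³) → C^N(T³)` is a bounded operator"). This file proves that transfer in the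
tree's vocabulary — with the cutoff on the KERNEL (the compactly supported near part
`Γ₀ = θΓ = newtonNear r₀ r₁` of the Newtonian kernel, `NewtonKernel.lean`) rather than on the
density, which is what the tree's Hölder theory of compactly supported Calderón–Zygmund kernels
(`HolderCZKernel.lean`, `NewtonNearCZ.lean`, `NewtonNearGradPotential.lean`) consumes:

* `newtonNearPotential_fderiv_apply_eq_newtonNearGradPotential` — **`N[∂ₐG] = T⁰_a G`**:
  `∫ Γ₀(z) ∂ₐG(x - z) dz = ∫ ∂ₐΓ₀(x - y) G(y) dy` for `G ∈ C¹(ℝ³)` (integration by parts against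
  the `W^{1,1}` kernel `Γ`, `integral_newtonKernel_smul_fderiv_eq`, localised by the cutoff `θ`);
* `czDiff_newtonNearHess_eq_newtonNearPotential` — **`S_{ab} G = N[∂_b∂ₐG]`**: the singular
  integral on differences `czDiff (newtonNearHess r₀ r₁ a b) G x = ∫ ∂_b∂ₐΓ₀(x-y)(G(y) - G(x))dy`
  of a `C²` function with bounded first and second derivatives is the truncated Newtonian
  potential of `∂_b∂ₐG` (`NewtonNearGradPotential`: `D T⁰_a G = S_{a·}G`), whence its smoothness,
  linearity and the commutation `∂_e S_{ab} G = S_{ab} (∂_e G)`;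
* `lift_rieszHessian_eq` — **the transfer**: for smooth `h` on `T³`, with `H` the periodic lift of
  `h` and `U` that of `Δ⁻¹h`,
  `lift (∂ᵢ∂ⱼΔ⁻¹ h) x = czDiff (∂ᵢ∂ⱼΓ₀) H x + ∫ ∂ᵢ∂ⱼλ(x - y) U(y) dy`
  (`λ = Δ((1-θ)Γ) = newtonFarLaplacian`, smooth with compact support; Green's representation at a
  fixed scale `U = N[ΔU] + Λ[U]`, `NewtonLocalPotential.eq_newtonNearPotential_laplacian_add`, with
  `ΔU = H - ∫h`), and the bounds of the smoothing remainder `x ↦ ∫ k(x-y) U(y) dy` for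
  `k ∈ C¹_c` and bounded continuous `U`: `‖·‖ ≤ ‖k‖_{L¹}‖U‖_∞`, derivative
  `∫ Dk(x-y) U(y) dy` (`KernelSideDifferentiation`).

## References

* T. Buckmaster, C. De Lellis, L. Székelyhidi Jr., V. Vicol, CPAM 72 (2019) = arXiv:1701.08678,
  App. D, Prop. D.1 and its proof (periodic transfer). [`BuckmasterEtAl2018`]
* D. Gilbarg, N. S. Trudinger, *Elliptic PDE of Second Order* (2001), (2.16)–(2.17), Lemma 4.1,
  Lemma 4.2 with (4.10). [`GilbargTrudinger2001`]
-/

noncomputable section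

open MeasureTheory Set Function Filter Metric Real InnerProductSpace
open _root_.Topology
open scoped NNReal ENNReal Laplacian

namespace Literature.Analysis.FluidPDE


variable {r₀ r₁ : ℝ}


/-- A differentiable map on `(EuclideanSpace ℝ (Fin 3))` with `‖Df‖ ≤ L` is `L`-Lipschitz (mean value inequality).
[folklore] -/
theorem lipschitzWith_of_differentiable_of_norm_fderiv_le {F' : Type*} [NormedAddCommGroup F'] [NormedSpace ℝ F']
    {f : (EuclideanSpace ℝ (Fin 3)) → F'} (hf : Differentiable ℝ f) {L : ℝ≥0} (hL : ∀ x, ‖fderiv ℝ f x‖ ≤ L) :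
    LipschitzWith L f :=
  lipschitzWith_of_nnnorm_fderiv_le hf fun x => by exact_mod_cast hL x

/-! ## Integration by parts against `Γ₀`: `N[∂ₐG] = T⁰_a G` -/

section Transfer

/-- The product rule for `Γ₀ = θΓ` off the origin:
`DΓ₀(v) a = θ(v) DΓ(v) a + Γ(v) Dθ(v) a`. [folklore] -/
theorem fderiv_newtonNear_apply_eq {v : (EuclideanSpace ℝ (Fin 3))} (hv : v ≠ 0) (a : (EuclideanSpace ℝ (Fin 3))) :
    fderiv ℝ (newtonNear r₀ r₁) v a =
      radialCutoff r₀ r₁ v * fderiv ℝ newtonKernel v a + newtonKernel v * fderiv ℝ (radialCutoff r₀ r₁) v a := by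
  have hθ : HasFDerivAt (radialCutoff r₀ r₁ : (EuclideanSpace ℝ (Fin 3)) → ℝ) (fderiv ℝ (radialCutoff r₀ r₁) v) v :=
    (((radialCutoff_contDiff r₀ r₁ (n := 1)).differentiable one_ne_zero) v).hasFDerivAt
  have hΓ : HasFDerivAt newtonKernel (fderiv ℝ newtonKernel v) v :=
    (hasFDerivAt_newtonKernel hv).differentiableAt.hasFDerivAt
  have h := hθ.mul hΓ
  have hfun : (radialCutoff r₀ r₁ * newtonKernel : (EuclideanSpace ℝ (Fin 3)) → ℝ) = newtonNear r₀ r₁ := rfl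
  rw [hfun] at h
  rw [h.fderiv]
  simp only [add_apply, smul_apply, smul_eq_mul]

/-- The kernel `Γ ∂ₐθ` of the cutoff correction is integrable (bounded, supported in the shell
`r₀ ≤ |v| ≤ r₁`). [folklore] -/
theorem integrable_newtonKernel_mul_fderiv_radialCutoff (h₀ : 0 < r₀) (h₁ : r₀ < r₁) (a : (EuclideanSpace ℝ (Fin 3))) :
    Integrable fun v : (EuclideanSpace ℝ (Fin 3)) => newtonKernel v * fderiv ℝ (radialCutoff r₀ r₁) v a := by
  -- a bound for `Dθ`
  obtain ⟨B, hB⟩ := ((radialCutoff_contDiff r₀ r₁ (n := 1)).continuous_fderiv one_ne_zero).bounded_above_of_compact_support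
    ((hasCompactSupport_radialCutoff (E := (EuclideanSpace ℝ (Fin 3))) h₀.le h₁).fderiv (𝕜 := ℝ))
  have hB0 : 0 ≤ B := (norm_nonneg _).trans (hB 0)
  set C : ℝ := (4 * π * r₀)⁻¹ * (B * ‖a‖) with hC
  have hmaj : Integrable ((closedBall (0 : (EuclideanSpace ℝ (Fin 3))) r₁).indicator fun _ => C) := by
    refine IntegrableOn.integrable_indicator ?_ measurableSet_closedBall
    exact integrableOn_const (hs := (measure_closedBall_lt_top (x := (0 : (EuclideanSpace ℝ (Fin 3)))) (r := r₁)).ne)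
  refine hmaj.mono' ?_ (Eventually.of_forall fun v => ?_)
  · exact (measurable_newtonKernel.mul
      ((((radialCutoff_contDiff r₀ r₁ (n := 1)).continuous_fderiv one_ne_zero).clm_apply
        continuous_const).measurable)).aestronglyMeasurable
  · -- pointwise bound
    by_cases hv0 : ‖v‖ < r₀
    · -- `θ = 1` near `v`: the derivative vanishes
      have hD : fderiv ℝ (radialCutoff r₀ r₁ : (EuclideanSpace ℝ (Fin 3)) → ℝ) v = 0 := by
        rw [Filter.EventuallyEq.fderiv_eq (f := fun _ => (1 : ℝ))
          (radialCutoff_eventuallyEq_one h₀.le h₁ (z := v) hv0)]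
        exact fderiv_const_apply 1
      rw [hD]
      simp only [mul_zero, norm_zero, zero_apply]
      exact indicator_nonneg (fun _ _ => by positivity) v
    · by_cases hv1 : r₁ < ‖v‖
      · have hD : fderiv ℝ (radialCutoff r₀ r₁ : (EuclideanSpace ℝ (Fin 3)) → ℝ) v = 0 := by
          rw [Filter.EventuallyEq.fderiv_eq (f := fun _ => (0 : ℝ))
            (radialCutoff_eventuallyEq_zero h₀.le h₁ (z := v) hv1)]
          exact fderiv_const_apply 0
        rw [hD]
        simp only [mul_zero, norm_zero, zero_apply]
        exact indicator_nonneg (fun _ _ => by positivity) v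
      · -- the shell `r₀ ≤ |v| ≤ r₁`
        have hvr : r₀ ≤ ‖v‖ := not_lt.1 hv0
        have hvmem : v ∈ closedBall (0 : (EuclideanSpace ℝ (Fin 3))) r₁ := mem_closedBall_zero_iff.2 (not_lt.1 hv1)
        rw [indicator_of_mem hvmem, norm_mul, Real.norm_eq_abs, abs_newtonKernel]
        have h1 : (4 * π * ‖v‖)⁻¹ ≤ (4 * π * r₀)⁻¹ := by
          apply inv_anti₀ (by positivity)
          have := Real.pi_pos
          nlinarith
        have h2 : ‖fderiv ℝ (radialCutoff r₀ r₁ : (EuclideanSpace ℝ (Fin 3)) → ℝ) v a‖ ≤ B * ‖a‖ :=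
          (ContinuousLinearMap.le_opNorm _ _).trans (mul_le_mul_of_nonneg_right (hB v) (norm_nonneg _))
        rw [hC]
        exact mul_le_mul h1 h2 (norm_nonneg _) (by positivity)

/-- **`N[∂ₐG] = T⁰_a G`**: for `G ∈ C¹((EuclideanSpace ℝ (Fin 3)))` the truncated Newtonian potential of a directional
derivative is the near gradient potential of `G`,
`∫ Γ₀(z) ∂ₐG(x - z) dz = ∫ ∂ₐΓ₀(x - y) G(y) dy` (integration by parts against the `W^{1,1}`
kernel `Γ`, `integral_newtonKernel_smul_fderiv_eq`, with the test function `θ(x - ·) G`;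
Gilbarg–Trudinger, Lemma 4.1: `D(Γ ⋆ f) = DΓ ⋆ f`). [cite: GilbargTrudinger2001, Lemma 4.1] -/
theorem newtonNearPotential_fderiv_apply_eq_newtonNearGradPotential (h₀ : 0 < r₀) (h₁ : r₀ < r₁)
    {G : (EuclideanSpace ℝ (Fin 3)) → ℝ} (hG : ContDiff ℝ 1 G) (a x : (EuclideanSpace ℝ (Fin 3))) :
    newtonNearPotential r₀ r₁ (fun w => fderiv ℝ G w a) x = newtonNearGradPotential r₀ r₁ a G x := by
  set θ : (EuclideanSpace ℝ (Fin 3)) → ℝ := radialCutoff r₀ r₁ with hθ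
  have hθs : ContDiff ℝ 1 θ := radialCutoff_contDiff r₀ r₁
  have hGc : Continuous G := hG.continuous
  have hDG : Continuous fun w => fderiv ℝ G w a := (hG.continuous_fderiv one_ne_zero).clm_apply continuous_const
  -- the test function `Φ = θ(x - ·) G`
  set Φ : (EuclideanSpace ℝ (Fin 3)) → ℝ := fun w => θ (x - w) * G w with hΦ
  have hθx : ContDiff ℝ 1 fun w : (EuclideanSpace ℝ (Fin 3)) => θ (x - w) := hθs.comp (contDiff_const.sub contDiff_id)
  have hΦs : ContDiff ℝ 1 Φ := hθx.mul hG
  have hΦc : HasCompactSupport Φ := by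
    refine HasCompactSupport.of_support_subset_isCompact (isCompact_closedBall x r₁) fun w hw => ?_
    rw [mem_closedBall, dist_comm, dist_eq_norm]
    by_contra hlt
    apply hw
    show θ (x - w) * G w = 0
    rw [hθ, radialCutoff_eq_zero h₀.le h₁ (not_le.1 hlt).le, zero_mul]
  -- derivative of the test function
  have hDΦ : ∀ w, fderiv ℝ Φ w a = θ (x - w) * fderiv ℝ G w a - fderiv ℝ θ (x - w) a * G w := by
    intro w
    have h1 : HasFDerivAt (fun w : (EuclideanSpace ℝ (Fin 3)) => θ (x - w)) ((fderiv ℝ θ (x - w)).comp (-ContinuousLinearMap.id ℝ (EuclideanSpace ℝ (Fin 3)))) w := by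
      have ha : HasFDerivAt (fun w : (EuclideanSpace ℝ (Fin 3)) => x - w) (-ContinuousLinearMap.id ℝ (EuclideanSpace ℝ (Fin 3))) w :=
        (hasFDerivAt_id w).const_sub x
      exact ((hθs.differentiable one_ne_zero) (x - w)).hasFDerivAt.comp w ha
    have h2 : HasFDerivAt G (fderiv ℝ G w) w := ((hG.differentiable one_ne_zero) w).hasFDerivAt
    have hΦ' : Φ = (fun w => θ (x - w)) * G := rfl
    rw [hΦ', (h1.mul h2).fderiv]
    simp only [add_apply, smul_apply, smul_eq_mul,
      ContinuousLinearMap.comp_apply, neg_apply, ContinuousLinearMap.id_apply,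
      map_neg]
    ring
  -- integration by parts against `Γ`
  have hIBP := integral_newtonKernel_smul_fderiv_eq (F := ℝ) hΦs hΦc x a
  simp only [smul_eq_mul] at hIBP
  -- the three integrable pieces
  set k₂ : (EuclideanSpace ℝ (Fin 3)) → ℝ := fun v => newtonKernel v * fderiv ℝ θ v a with hk₂
  have hk₂i : Integrable k₂ := integrable_newtonKernel_mul_fderiv_radialCutoff h₀ h₁ a
  have hk₂0 : ∀ v : (EuclideanSpace ℝ (Fin 3)), r₁ < ‖v‖ → k₂ v = 0 := fun v hv => by
    have hD : fderiv ℝ θ v = 0 := by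
      rw [hθ, Filter.EventuallyEq.fderiv_eq (f := fun _ => (0 : ℝ))
        (radialCutoff_eventuallyEq_zero h₀.le h₁ (z := v) hv)]
      exact fderiv_const_apply 0
    simp [hk₂, hD]
  have hP : Integrable fun w => newtonNear r₀ r₁ (x - w) * fderiv ℝ G w a := by
    simpa only [smul_eq_mul] using integrable_kernel_sub_smul (F := ℝ) (integrable_newtonNear h₀.le h₁)
      (newtonNear_eq_zero_of_lt h₀.le h₁) hDG x
  have hQ : Integrable fun w => k₂ (x - w) * G w := by
    simpa only [smul_eq_mul] using integrable_kernel_sub_smul (F := ℝ) hk₂i hk₂0 hGc x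
  have hR : Integrable fun w => newtonNearGrad r₀ r₁ a (x - w) * G w := by
    simpa only [smul_eq_mul] using integrable_kernel_sub_smul (F := ℝ) (integrable_newtonNearGrad h₀ h₁ a)
      (fun z hz => newtonNearGrad_eq_zero_of_lt h₀.le h₁ a hz) hGc x
  -- pointwise identities off the diagonal `w = x`
  have hae : ∀ᵐ w ∂(volume : Measure (EuclideanSpace ℝ (Fin 3))), w ≠ x := by
    rw [ae_iff]
    simp
  have hL : (fun w => newtonKernel (x - w) * fderiv ℝ Φ w a) =ᵐ[volume]
      fun w => newtonNear r₀ r₁ (x - w) * fderiv ℝ G w a - k₂ (x - w) * G w := by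
    filter_upwards [hae] with w hw
    rw [hDΦ w]
    simp only [hk₂, newtonNear]
    ring
  have hRt : (fun w => fderiv ℝ newtonKernel (x - w) a * Φ w) =ᵐ[volume]
      fun w => newtonNearGrad r₀ r₁ a (x - w) * G w - k₂ (x - w) * G w := by
    filter_upwards [hae] with w hw
    have hv : x - w ≠ 0 := sub_ne_zero.2 (Ne.symm hw)
    rw [newtonNearGrad_apply, fderiv_newtonNear_apply_eq hv a]
    simp only [hΦ, hk₂]
    ring
  rw [integral_congr_ae hL, integral_congr_ae hRt, integral_sub hP hQ, integral_sub hR hQ] at hIBP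
  have hPR : ∫ w, newtonNear r₀ r₁ (x - w) * fderiv ℝ G w a = ∫ w, newtonNearGrad r₀ r₁ a (x - w) * G w := by
    linarith
  -- rewrite both sides of the goal
  rw [newtonNearPotential_apply, newtonNearGradPotential]
  simp only [smul_eq_mul]
  rw [← hPR]
  have h := integral_sub_left_eq_self (fun w => newtonNear r₀ r₁ (x - w) * fderiv ℝ G w a) volume x
  simp only [sub_sub_cancel] at h
  exact h

end Transfer

/-! ## `S_{ab} G = N[∂_b∂ₐG]`: the singular integral on differences of a `C²` function -/

section CZDiff

/-- **`S_{ab}G = N[∂_b∂ₐG]`**: for `G ∈ C²((EuclideanSpace ℝ (Fin 3)))`, globally `γ`-Hölder (`0 < γ < 1`), the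
Calderón–Zygmund singular integral on differences with the Hessian kernel of the truncated
Newtonian kernel is the truncated Newtonian potential of the second derivative:
`∫ ∂_b∂ₐΓ₀(x - y)(G(y) - G(x)) dy = ∫ Γ₀(z) ∂_b∂ₐG(x - z) dz`
(`D T⁰_a G = S_{a·} G`, `NewtonNearGradPotential`; `T⁰_a G = N[∂ₐG]`; `D N[g] = N[Dg]`).
[cite: GilbargTrudinger2001, Lemma 4.2 with (4.10)] -/
theorem czDiff_newtonNearHess_eq_newtonNearPotential (h₀ : 0 < r₀) (h₁ : r₀ < r₁) {G : (EuclideanSpace ℝ (Fin 3)) → ℝ}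
    (hG : ContDiff ℝ 2 G) {C γ : ℝ≥0} (hGh : HolderWith C γ G) (hγ : 0 < γ) (hγ1 : γ < 1)
    (a b x : (EuclideanSpace ℝ (Fin 3))) :
    czDiff (newtonNearHess r₀ r₁ a b) G x =
      newtonNearPotential r₀ r₁ (fun w => fderiv ℝ (fun y => fderiv ℝ G y a) w b) x := by
  have hga : ContDiff ℝ 1 fun y => fderiv ℝ G y a :=
    (hG.fderiv_right (m := 1) le_rfl).clm_apply contDiff_const
  have h1 : fderiv ℝ (newtonNearGradPotential r₀ r₁ a G) x b = czDiff (newtonNearHess r₀ r₁ a b) G x :=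
    fderiv_newtonNearGradPotential_apply h₀ h₁ a hGh hγ hγ1 x b
  have h2 : newtonNearGradPotential r₀ r₁ a G = newtonNearPotential r₀ r₁ (fun w => fderiv ℝ G w a) :=
    funext fun y =>
      (newtonNearPotential_fderiv_apply_eq_newtonNearGradPotential h₀ h₁ (hG.of_le one_le_two) a y).symm
  rw [← h1, h2, fderiv_newtonNearPotential_apply h₀.le h₁ hga x b]

/-- **Linearity of `S_{ab}` in the density** (absolutely convergent integrals for Hölder
densities, `IsHolderCZKernel.integrable_czDiff`): differences. [folklore] -/
theorem czDiff_sub {K : (EuclideanSpace ℝ (Fin 3)) → ℝ} {ρ A B A₀ : ℝ} (hK : IsHolderCZKernel K ρ A B A₀)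
    {F₁ : Type*} [NormedAddCommGroup F₁] [NormedSpace ℝ F₁] {f g : (EuclideanSpace ℝ (Fin 3)) → F₁} {Cf Cg γ : ℝ≥0}
    (hf : HolderWith Cf γ f) (hg : HolderWith Cg γ g) (hγ : 0 < γ) (hγ1 : γ < 1) (x : (EuclideanSpace ℝ (Fin 3))) :
    czDiff K (fun y => f y - g y) x = czDiff K f x - czDiff K g x := by
  simp only [czDiff]
  rw [← integral_sub (hK.integrable_czDiff hf hγ hγ1 x) (hK.integrable_czDiff hg hγ hγ1 x)]
  refine integral_congr_ae (Eventually.of_forall fun y => ?_)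
  simp only [smul_sub]
  abel

/-- **The commutator of `S_{ab}` with a multiplication, as one absolutely convergent integral**:
`S_{ab}(gf)(x) - g(x) S_{ab}f(x) = ∫ K(x - y)(g(y) - g(x)) f(y) dy` for Hölder `f`, `gf`. [folklore] -/
theorem czDiff_mul_sub_mul_czDiff {K : (EuclideanSpace ℝ (Fin 3)) → ℝ} {ρ A B A₀ : ℝ} (hK : IsHolderCZKernel K ρ A B A₀)
    {f g : (EuclideanSpace ℝ (Fin 3)) → ℝ} {Cf Cgf γ : ℝ≥0} (hf : HolderWith Cf γ f) (hgf : HolderWith Cgf γ fun y => g y * f y)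
    (hγ : 0 < γ) (hγ1 : γ < 1) (x : (EuclideanSpace ℝ (Fin 3))) :
    czDiff K (fun y => g y * f y) x - g x * czDiff K f x = ∫ y, K (x - y) * ((g y - g x) * f y) := by
  simp only [czDiff, smul_eq_mul]
  rw [← integral_const_mul, ← integral_sub]
  · refine integral_congr_ae (Eventually.of_forall fun y => ?_)
    ring
  · simpa only [smul_eq_mul] using hK.integrable_czDiff hgf hγ hγ1 x
  · simpa only [smul_eq_mul] using (hK.integrable_czDiff hf hγ hγ1 x).const_mul (g x)

end CZDiff

/-! ## Smoothing integrals `x ↦ ∫ k(x - y) U(y) dy` with `k ∈ C¹_c` and bounded continuous `U` -/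

section Smoothing

variable {k : (EuclideanSpace ℝ (Fin 3)) → ℝ} {U : (EuclideanSpace ℝ (Fin 3)) → ℝ}

/-- **Sup bound**: `|∫ k(x - y) U(y) dy| ≤ ‖k‖_{L¹} sup|U|` for integrable `k` and bounded `U`.
[folklore] -/
theorem norm_integral_kernel_sub_mul_le (hk : Integrable k) {M : ℝ} (hM : ∀ y, ‖U y‖ ≤ M) (x : (EuclideanSpace ℝ (Fin 3))) :
    ‖∫ y, k (x - y) * U y‖ ≤ (∫ z, ‖k z‖) * M := by
  have hM0 : 0 ≤ M := (norm_nonneg _).trans (hM 0)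
  have hkx : Integrable (fun y => k (x - y)) := hk.comp_sub_left x
  calc ‖∫ y, k (x - y) * U y‖ ≤ ∫ y, ‖k (x - y)‖ * M := by
        refine norm_integral_le_of_norm_le (hkx.norm.mul_const M) (Eventually.of_forall fun y => ?_)
        rw [norm_mul]
        exact mul_le_mul_of_nonneg_left (hM y) (norm_nonneg _)
    _ = (∫ z, ‖k z‖) * M := by
        rw [integral_mul_const]
        congr 1
        exact integral_sub_left_eq_self (fun z => ‖k z‖) volume x

/-- **Derivative on the kernel**: for `k ∈ C¹_c` and continuous `U`,
`∂ₐ ∫ k(x - y) U(y) dy = ∫ ∂ₐk(x - y) U(y) dy` (`KernelSideDifferentiation`). [folklore] -/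
theorem fderiv_integral_kernel_sub_mul_apply (hk : ContDiff ℝ 1 k) (hkc : HasCompactSupport k)
    (hU : Continuous U) (x a : (EuclideanSpace ℝ (Fin 3))) :
    fderiv ℝ (fun x => ∫ y, k (x - y) * U y) x a = ∫ y, fderiv ℝ k (x - y) a * U y := by
  have h := fderiv_integral_kernel_sub_smul_apply (F := ℝ) hk hkc hU x a
  simpa only [smul_eq_mul] using h

/-- The smoothing integral of a continuous density against a `C¹_c` kernel is differentiable.
[folklore] -/
theorem differentiable_integral_kernel_sub_mul (hk : ContDiff ℝ 1 k) (hkc : HasCompactSupport k)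
    (hU : Continuous U) : Differentiable ℝ fun x => ∫ y, k (x - y) * U y := fun x => by
  have h := hasFDerivAt_integral_kernel_sub_smul (F := ℝ) hk hkc hU x
  have hfun : (fun x => ∫ y, k (x - y) • U y) = fun x => ∫ y, k (x - y) * U y := by
    funext x'; simp only [smul_eq_mul]
  rw [hfun] at h
  exact h.differentiableAt

/-- **The directional derivative as a smoothing integral with the derived kernel**: for
`k ∈ C²_c`, `x ↦ ∂ₐ∫ k(x-y)U(y)dy = ∫ (∂ₐk)(x-y)U(y)dy` is again of the same form, with the
`C¹_c` kernel `∂ₐk`. [folklore] -/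
theorem fderiv_integral_kernel_sub_mul_eq (hk : ContDiff ℝ 2 k) (hkc : HasCompactSupport k)
    (hU : Continuous U) (a : (EuclideanSpace ℝ (Fin 3))) :
    (fun x => fderiv ℝ (fun x => ∫ y, k (x - y) * U y) x a) = fun x => ∫ y, (fun z => fderiv ℝ k z a) (x - y) * U y :=
  funext fun x => fderiv_integral_kernel_sub_mul_apply (hk.of_le one_le_two) hkc hU x a

/-- The derived kernel `∂ₐk` of a `C^{n+1}_c` kernel is `Cⁿ_c`. [folklore] -/
theorem contDiff_hasCompactSupport_fderiv_apply_kernel {n : ℕ∞} (hk : ContDiff ℝ (n + 1) k)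
    (hkc : HasCompactSupport k) (a : (EuclideanSpace ℝ (Fin 3))) :
    ContDiff ℝ n (fun z => fderiv ℝ k z a) ∧ HasCompactSupport fun z => fderiv ℝ k z a :=
  ⟨(hk.fderiv_right (m := n) le_rfl).clm_apply contDiff_const, hkc.fderiv_apply (𝕜 := ℝ) a⟩

/-- **Lipschitz bound for the smoothing integral**: for `k ∈ C¹_c` with `‖Dk‖ ≤ D` vanishing off
the ball of radius `R`, and `‖U‖ ≤ M`,
`|∫ k(x-y)U(y)dy - ∫ k(x'-y)U(y)dy| ≤ D · M · |B_{R}| … ` — rendered through the mean value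
inequality with the derivative bound `‖∂ₐk‖_{L¹} M`. [folklore] -/
theorem lipschitzWith_integral_kernel_sub_mul (hk : ContDiff ℝ 1 k) (hkc : HasCompactSupport k)
    (hU : Continuous U) {M : ℝ} (hM : ∀ y, ‖U y‖ ≤ M) {L : ℝ≥0}
    (hL : ∀ a : (EuclideanSpace ℝ (Fin 3)), ‖a‖ ≤ 1 → (∫ z, ‖fderiv ℝ k z a‖) * M ≤ L) :
    LipschitzWith L fun x => ∫ y, k (x - y) * U y := by
  have hdiff := differentiable_integral_kernel_sub_mul hk hkc hU
  refine lipschitzWith_of_differentiable_of_norm_fderiv_le hdiff fun x => ?_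
  refine ContinuousLinearMap.opNorm_le_bound _ L.coe_nonneg fun a => ?_
  rcases eq_or_ne a 0 with rfl | ha
  · simp
  · -- reduce to unit vectors by homogeneity
    have hna : 0 < ‖a‖ := norm_pos_iff.2 ha
    set u : (EuclideanSpace ℝ (Fin 3)) := ‖a‖⁻¹ • a with hu
    have hun : ‖u‖ ≤ 1 := by
      rw [hu, norm_smul, norm_inv, norm_norm, inv_mul_cancel₀ hna.ne']
    have hau : a = ‖a‖ • u := by
      rw [hu, smul_smul, mul_inv_cancel₀ hna.ne', one_smul]
    have hka : Integrable fun z => fderiv ℝ k z u :=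
      ((hk.continuous_fderiv one_ne_zero).clm_apply continuous_const).integrable_of_hasCompactSupport
        (hkc.fderiv_apply (𝕜 := ℝ) u)
    have hb := norm_integral_kernel_sub_mul_le hka hM x
    have hfd : ‖fderiv ℝ (fun x => ∫ y, k (x - y) * U y) x u‖ ≤ L := by
      rw [fderiv_integral_kernel_sub_mul_apply hk hkc hU x u]
      exact hb.trans (hL u hun)
    calc ‖fderiv ℝ (fun x => ∫ y, k (x - y) * U y) x a‖
        = ‖a‖ * ‖fderiv ℝ (fun x => ∫ y, k (x - y) * U y) x u‖ := by
          conv_lhs => rw [hau]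
          rw [map_smul, norm_smul, norm_norm]
      _ ≤ ‖a‖ * L := mul_le_mul_of_nonneg_left hfd hna.le
      _ = L * ‖a‖ := mul_comm _ _

end Smoothing

/-! ## The transfer: Riesz–Hessian transforms of the torus through the truncated Newtonian kernel -/

section TorusTransfer

open FunctionSpaces


/-- **Bounds for the periodic lift of a smooth function**: `lift h` is bounded together with its
derivative (continuity on the compact torus; `D(lift h) = (Torus.fderiv h) ∘ proj`). [folklore] -/
theorem exists_lift_bounds {h : (UnitAddTorus (Fin 3)) → ℝ} (hh : Torus.IsSmooth h) :
    ∃ M L : ℝ, 0 ≤ M ∧ 0 ≤ L ∧ (∀ y, ‖Torus.lift h y‖ ≤ M) ∧ ∀ y, ‖fderiv ℝ (Torus.lift h) y‖ ≤ L := by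
  obtain ⟨M, hM⟩ := Torus.exists_forall_norm_le_of_continuous hh.continuous
  obtain ⟨L, hL⟩ := Torus.exists_forall_norm_le_of_continuous (hh.isContDiff_torusFderiv 0).continuous
  refine ⟨max M 0, max L 0, le_max_right _ _, le_max_right _ _, fun y => ?_, fun y => ?_⟩
  · rw [Torus.lift_apply]; exact (hM _).trans (le_max_left _ _)
  · rw [Torus.fderiv_lift]; exact (hL _).trans (le_max_left _ _)

/-- **The periodic lift of a smooth function is Hölder of every exponent `γ ≤ 1`** (bounded and
Lipschitz). [folklore] -/
theorem exists_holderWith_lift {h : (UnitAddTorus (Fin 3)) → ℝ} (hh : Torus.IsSmooth h) {γ : ℝ≥0} (hγ1 : γ ≤ 1) :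
    ∃ C : ℝ≥0, HolderWith C γ (Torus.lift h) := by
  obtain ⟨M, L, -, hL0, hM, hL⟩ := exists_lift_bounds hh
  have hdiff : Differentiable ℝ (Torus.lift h) := ContDiff.differentiable hh (by simp)
  have hLip : LipschitzWith L.toNNReal (Torus.lift h) :=
    lipschitzWith_of_differentiable_of_norm_fderiv_le hdiff fun y => by rw [Real.coe_toNNReal _ hL0]; exact hL y
  exact ⟨_, holderWith_of_lipschitzWith_of_norm_le hγ1 hLip hM⟩

/-- The periodic lift of `∂ᵢ∂ⱼ g` is the second directional derivative of the lift. [folklore] -/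
theorem lift_partialDeriv_partialDeriv_eq {g : (UnitAddTorus (Fin 3)) → ℝ} (hg : Torus.IsSmooth g) (i j : Fin 3) :
    Torus.lift (Torus.partialDeriv i (Torus.partialDeriv j g)) = fun y =>
      fderiv ℝ (fun z => fderiv ℝ (Torus.lift g) z (EuclideanSpace.single j 1)) y (EuclideanSpace.single i 1) := by
  have h1 : Torus.IsContDiff 1 (Torus.partialDeriv j g) := (hg.partialDeriv j).isContDiff (by simp)
  have h2 : Torus.IsContDiff 1 g := hg.isContDiff (by simp)
  rw [Torus.lift_partialDeriv_eq h1 i, Torus.lift_partialDeriv_eq h2 j]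

/-- The Laplacian of the lift of `Δ⁻¹h` is `lift h - ∫ h`. [folklore] -/
theorem laplacian_lift_invLaplacian {h : (UnitAddTorus (Fin 3)) → ℝ} (hh : Torus.IsSmooth h) :
    Δ (Torus.lift (Torus.invLaplacian h)) = fun y => Torus.lift h y - ∫ x, h x := by
  funext y
  rw [Torus.laplacian_lift, Torus.laplacian_invLaplacian hh, Torus.lift_apply]

/-- **The transfer `T³ → (EuclideanSpace ℝ (Fin 3))` for the Riesz–Hessian transforms** (BDSV App. D, proof of Prop. D.1:
"`T_K f(x) = p.v.∫ K(x-y)χ(y)f(y)dy + T_smooth f(x)`", here with the cutoff on the kernel). For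
smooth `h` on `T³`, with `H = lift h` and `U = lift (Δ⁻¹h)`, for every `y ∈ (EuclideanSpace ℝ (Fin 3))`:
`lift (∂ᵢ∂ⱼΔ⁻¹h)(y) = ∫ ∂ᵢ∂ⱼΓ₀(y - w)(H(w) - H(y)) dw + ∫ ∂ᵢ∂ⱼλ(y - w) U(w) dw`,
`Γ₀ = newtonNear r₀ r₁` the truncated Newtonian kernel and `λ = newtonFarLaplacian r₀ r₁` the
smooth compactly supported Laplacian of the far kernel: Green's representation at a fixed scale
`U = N[ΔU] + Λ[U]` (`eq_newtonNearPotential_laplacian_add`) with `ΔU = H - ∫h`, two derivatives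
(falling on the density in `N`, on the kernel in `Λ`), and `N[∂ᵢ∂ⱼH] = S_{ji}H`
(`czDiff_newtonNearHess_eq_newtonNearPotential`). [cite: BuckmasterEtAl2018, App. D (proof of Prop. D.1)] -/
theorem lift_rieszHessian_eq (h₀ : 0 < r₀) (h₁ : r₀ < r₁) {h : (UnitAddTorus (Fin 3)) → ℝ} (hh : Torus.IsSmooth h)
    (i j : Fin 3) (y : (EuclideanSpace ℝ (Fin 3))) :
    Torus.lift (BDSV.rieszHessian i j h) y =
      czDiff (newtonNearHess r₀ r₁ (EuclideanSpace.single j 1) (EuclideanSpace.single i 1)) (Torus.lift h) y +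
        ∫ w, fderiv ℝ (fun v => fderiv ℝ (newtonFarLaplacian r₀ r₁) v (EuclideanSpace.single j 1)) (y - w)
          (EuclideanSpace.single i 1) * Torus.lift (Torus.invLaplacian h) w := by
  set eI : (EuclideanSpace ℝ (Fin 3)) := EuclideanSpace.single i 1 with heI
  set eJ : (EuclideanSpace ℝ (Fin 3)) := EuclideanSpace.single j 1 with heJ
  set u : (UnitAddTorus (Fin 3)) → ℝ := Torus.invLaplacian h with hu
  set U : (EuclideanSpace ℝ (Fin 3)) → ℝ := Torus.lift u with hU_def
  set H : (EuclideanSpace ℝ (Fin 3)) → ℝ := Torus.lift h with hH_def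
  set lam : (EuclideanSpace ℝ (Fin 3)) → ℝ := newtonFarLaplacian r₀ r₁ with hlam
  have hus : Torus.IsSmooth u := Torus.isSmooth_invLaplacian hh
  have hU2 : ContDiff ℝ 2 U := hus.isContDiff (by decide)
  have hU1 : ContDiff ℝ 1 U := hus.isContDiff (by simp)
  have hH2 : ContDiff ℝ 2 H := hh.isContDiff (by decide)
  have hUc : Continuous U := hU1.continuous
  have hlam2 : ContDiff ℝ 2 lam := contDiff_newtonFarLaplacian h₀ h₁
  have hlam1 : ContDiff ℝ 1 lam := contDiff_newtonFarLaplacian h₀ h₁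
  have hlamc : HasCompactSupport lam := hasCompactSupport_newtonFarLaplacian h₀.le h₁
  -- (a) the left-hand side as a second directional derivative of `U`
  have hlhs : Torus.lift (BDSV.rieszHessian i j h) = fun y => fderiv ℝ (fun z => fderiv ℝ U z eJ) y eI := by
    rw [BDSV.rieszHessian_def]
    exact lift_partialDeriv_partialDeriv_eq hus i j
  -- (b) Green's representation `U = N[ΔU] + Λ[U]`, `ΔU = H - ∫h`
  set c : ℝ := ∫ x, h x with hc
  set g : (EuclideanSpace ℝ (Fin 3)) → ℝ := fun y => H y - c with hg
  have hΔU : Δ U = g := laplacian_lift_invLaplacian hh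
  have hg2 : ContDiff ℝ 2 g := hH2.sub contDiff_const
  have hg1 : ContDiff ℝ 1 g := hg2.of_le one_le_two
  have hgreen : U = fun y => newtonNearPotential r₀ r₁ g y + ∫ w, lam (y - w) * U w := by
    funext y
    rw [eq_newtonNearPotential_laplacian_add h₀ h₁ hU2 y, hΔU, newtonFarSmoothing_eq_integral_kernel]
    congr 1
    exact integral_congr_ae (Eventually.of_forall fun w => mul_comm _ _)
  -- (c) the first derivative
  set lamJ : (EuclideanSpace ℝ (Fin 3)) → ℝ := fun v => fderiv ℝ lam v eJ with hlamJ
  have hlamJ1 : ContDiff ℝ 1 lamJ := (hlam2.fderiv_right (m := 1) le_rfl).clm_apply contDiff_const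
  have hlamJc : HasCompactSupport lamJ := hlamc.fderiv_apply (𝕜 := ℝ) eJ
  have hgJ : (fun w => fderiv ℝ g w eJ) = fun w => fderiv ℝ H w eJ := by
    funext w
    rw [hg, fderiv_sub_const]
  have hHJ1 : ContDiff ℝ 1 fun w => fderiv ℝ H w eJ := (hH2.fderiv_right (m := 1) le_rfl).clm_apply contDiff_const
  have hD1 : (fun z => fderiv ℝ U z eJ) = fun z =>
      newtonNearPotential r₀ r₁ (fun w => fderiv ℝ H w eJ) z + ∫ w, lamJ (z - w) * U w := by
    funext z
    have hN : DifferentiableAt ℝ (newtonNearPotential r₀ r₁ g) z :=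
      ((contDiff_newtonNearPotential h₀.le h₁ 1 hg1).differentiable one_ne_zero) z
    have hS : DifferentiableAt ℝ (fun y => ∫ w, lam (y - w) * U w) z :=
      differentiable_integral_kernel_sub_mul hlam1 hlamc hUc z
    have hfun : U = newtonNearPotential r₀ r₁ g + fun y => ∫ w, lam (y - w) * U w := hgreen
    calc fderiv ℝ U z eJ = fderiv ℝ (newtonNearPotential r₀ r₁ g + fun y => ∫ w, lam (y - w) * U w) z eJ := by
          rw [← hfun]
      _ = newtonNearPotential r₀ r₁ (fun w => fderiv ℝ H w eJ) z + ∫ w, lamJ (z - w) * U w := by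
          rw [fderiv_add hN hS, add_apply, fderiv_newtonNearPotential_apply h₀.le h₁ hg1 z eJ, hgJ,
            fderiv_integral_kernel_sub_mul_apply hlam1 hlamc hUc z eJ]
  -- (d) the second derivative
  have hD2 : fderiv ℝ (fun z => fderiv ℝ U z eJ) y eI =
      newtonNearPotential r₀ r₁ (fun w => fderiv ℝ (fun v => fderiv ℝ H v eJ) w eI) y +
        ∫ w, fderiv ℝ lamJ (y - w) eI * U w := by
    have hN : DifferentiableAt ℝ (newtonNearPotential r₀ r₁ fun w => fderiv ℝ H w eJ) y :=
      ((contDiff_newtonNearPotential h₀.le h₁ 1 hHJ1).differentiable one_ne_zero) y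
    have hS : DifferentiableAt ℝ (fun z => ∫ w, lamJ (z - w) * U w) y :=
      differentiable_integral_kernel_sub_mul hlamJ1 hlamJc hUc y
    rw [hD1, show (fun z => newtonNearPotential r₀ r₁ (fun w => fderiv ℝ H w eJ) z + ∫ w, lamJ (z - w) * U w) =
        newtonNearPotential r₀ r₁ (fun w => fderiv ℝ H w eJ) + fun z => ∫ w, lamJ (z - w) * U w from rfl,
      fderiv_add hN hS, add_apply, fderiv_newtonNearPotential_apply h₀.le h₁ hHJ1 y eI,
      fderiv_integral_kernel_sub_mul_apply hlamJ1 hlamJc hUc y eI]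
  -- (e) the CZ singular integral on differences
  obtain ⟨C, hC⟩ := exists_holderWith_lift hh (γ := 1 / 2) (by norm_num)
  have hT2 := czDiff_newtonNearHess_eq_newtonNearPotential h₀ h₁ hH2 hC (by norm_num) (by norm_num) eJ eI y
  rw [hlhs]
  show fderiv ℝ (fun z => fderiv ℝ U z eJ) y eI = czDiff (newtonNearHess r₀ r₁ eJ eI) H y +
    ∫ w, fderiv ℝ lamJ (y - w) eI * U w
  rw [hD2, hT2]

end TorusTransfer

end Literature.Analysis.FluidPDE
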